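import Mathlib
import Summits.Ventures.PercRepro2.Harris
import Summits.Ventures.PercRepro2.BasePrime
import Summits.Ventures.PercRepro2.LocRows
import Summits.Ventures.PercRepro2.SwRow
import Summits.Ventures.PercRepro2.SwOutCube

/-!
# The twisted cube lemma WITH far arms: vocabulary and counting (blind cell PercRepro2, night-4
g16, 2026-08-26; proofs/NIGHT4-G12.md §5′(b)–(d), proofs/NIGHT4-G16.md §6)

The abstract combinatorial core of the one-mixed-arm block of NIGHT4-G12.md §5′, now with the far
arms as further cube coordinates (G12 had this only as random tests).  A point of the block is
`(ε, ω)`: the seal bit `ε` of the dropped piece and a colouring `ω` of the ATOMS — `inl 0` = the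
coarse arm `X` of `u`, `inl 1` = the h-piece `A` of the mixed arm, `inr j` = the far arm `j`.  The
red edge set of a point is the set of its red atoms (`redAtoms ω`), the blue edge set the red atoms
of the flipped colouring, and the conditioning `Q` is a lower set of the product order.  The core
cube takes, in the top layer `ε = true`, the two points at which `X` and `A` have different colours
— the one-sided point and its mirror — with EVERY far colouring (`MidTop`).

This file: the vocabulary (`MidTop`, `redAtoms`, `setXA`, `redOK`, `blueOK`), the monotonicity
bookkeeping, the counting identities (a count over the block splits by the seal bit,
`card_filter_prod_bool`; the top layer minus the middle splits by the common colour of `X` and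
`A`, `card_filter_top`; a corner counts as its far fibre, `card_filter_fibre`) and the EXCHANGE
`|L₀ ∩ S₀| + |L₁ ∩ S₁| ≤ |L₀ ∩ S₁| + |L₁ ∩ S₀|` for `L₁ ⊆ L₀`, `S₀ ⊆ S₁` (`card_exchange`).
The theorem `mixedCubeFar_card_le` is in `SwOutMixedCubeFar`.
-/

namespace Summit.Ventures.PercRepro2

namespace MixedCube

open scoped Classical

variable {κ : Type*} [Fintype κ] [DecidableEq κ]

/-- The atoms: `inl 0` = the coarse arm `X` of `u`, `inl 1` = the h-piece `A` of the mixed arm,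
`inr j` = the far arm `j`. -/
abbrev Atom (κ : Type*) := Fin 2 ⊕ κ

/-- A point of the block: the seal bit and the colouring of the atoms. -/
abbrev PtF (κ : Type*) := Bool × Config (Atom κ)

/-- The removed points: the top layer, `X` and `A` of different colours (the one-sided point and
its mirror, with every far colouring). -/
def MidTop (p : PtF κ) : Prop := p.1 = true ∧ p.2 (Sum.inl 0) ≠ p.2 (Sum.inl 1)

/-- The red atoms of a colouring. -/
def redAtoms (ω : Config (Atom κ)) : Set (Atom κ) := {e | ω e = true}

/-- The colouring with `X` and `A` both of colour `c` and the far colouring `f`. -/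
def setXA (c : Bool) (f : Config κ) : Config (Atom κ) := Sum.elim (fun _ => c) f

/-- A red-accepted point of the block: in `Q`, not removed, red edge set in `𝓔`. -/
def redOK (Q : Set (PtF κ)) (𝓔 : Set (Set (Atom κ))) (p : PtF κ) : Prop :=
  p ∈ Q ∧ ¬ MidTop p ∧ redAtoms p.2 ∈ 𝓔

/-- A blue-accepted point of the block: in `Q`, not removed, blue edge set in `𝓔`. -/
def blueOK (Q : Set (PtF κ)) (𝓔 : Set (Set (Atom κ))) (p : PtF κ) : Prop :=
  p ∈ Q ∧ ¬ MidTop p ∧ redAtoms (flipAll p.2) ∈ 𝓔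

section Basic

omit [Fintype κ] [DecidableEq κ] in
/-- The red atoms grow with the colouring. -/
lemma redAtoms_mono {ω ω' : Config (Atom κ)} (h : ω ≤ ω') : redAtoms ω ⊆ redAtoms ω' := by
  intro e he
  have h1 := h e
  simp only [redAtoms, Set.mem_setOf_eq] at he ⊢
  rw [he] at h1
  cases h' : ω' e
  · rw [h'] at h1; exact absurd h1 (by simp)
  · rfl

/-- `flipAll` reverses the order. -/
lemma flipAll_le_flipAll' {E' : Type*} {ω ω' : Config E'} (h : ω ≤ ω') :
    flipAll ω' ≤ flipAll ω := by
  intro e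
  have := h e
  simp only [flipAll]
  cases h1 : ω e <;> cases h2 : ω' e <;> simp_all

omit [Fintype κ] [DecidableEq κ] in
/-- `flipAll` of `setXA c f`. -/
lemma flipAll_setXA (c : Bool) (f : Config κ) : flipAll (setXA c f) = setXA (!c) (flipAll f) := by
  funext e
  cases e with
  | inl i => rfl
  | inr j => rfl

omit [Fintype κ] [DecidableEq κ] in
/-- `setXA` is monotone in the far colouring. -/
lemma setXA_mono (c : Bool) {f f' : Config κ} (h : f ≤ f') : setXA c f ≤ setXA c f' := by
  intro e
  cases e with
  | inl i => exact le_refl _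
  | inr j => exact h j

omit [Fintype κ] [DecidableEq κ] in
/-- `setXA false f ≤ setXA true f`. -/
lemma setXA_false_le_true (f : Config κ) : setXA false f ≤ setXA true f := by
  intro e
  cases e with
  | inl i => exact Bool.false_le _
  | inr j => exact le_refl _

omit [Fintype κ] [DecidableEq κ] in
/-- `setXA` is injective in the far colouring. -/
lemma setXA_injective (c : Bool) : Function.Injective (setXA c : Config κ → Config (Atom κ)) := by
  intro f f' h
  funext j
  exact congrFun h (Sum.inr j)

omit [Fintype κ] [DecidableEq κ] in
/-- A colouring with `X` and `A` of the same colour `c` is `setXA c` of its far part. -/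
lemma eq_setXA_of {ω : Config (Atom κ)} {c : Bool} (h0 : ω (Sum.inl 0) = c)
    (h1 : ω (Sum.inl 1) = c) : ω = setXA c (fun j => ω (Sum.inr j)) := by
  funext e
  cases e with
  | inl i =>
    fin_cases i
    · exact h0
    · exact h1
  | inr j => rfl

end Basic

section Counting

/-- Splitting a count over the block by the seal bit. -/
lemma card_filter_prod_bool (P : PtF κ → Prop) [DecidablePred P] :
    (Finset.univ.filter P).card =
      (Finset.univ.filter fun ω : Config (Atom κ) => P (false, ω)).card +
        (Finset.univ.filter fun ω : Config (Atom κ) => P (true, ω)).card := by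
  rw [← Finset.card_filter_add_card_filter_not (s := Finset.univ.filter P)
    (fun p : PtF κ => p.1 = false)]
  congr 1
  · have : (Finset.univ.filter P).filter (fun p : PtF κ => p.1 = false) =
        (Finset.univ.filter fun ω : Config (Atom κ) => P (false, ω)).image
          (fun ω => (false, ω)) := by
      ext p
      simp only [Finset.mem_filter, Finset.mem_univ, true_and, Finset.mem_image]
      constructor
      · rintro ⟨hP, hb⟩
        refine ⟨p.2, ?_, Prod.ext hb.symm rfl⟩
        have hp : (false, p.2) = p := Prod.ext hb.symm rfl
        rw [hp]; exact hP
      · rintro ⟨ω, hω, rfl⟩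
        exact ⟨hω, rfl⟩
    rw [this, Finset.card_image_of_injective]
    intro ω ω' h
    exact (Prod.mk.inj h).2
  · have : (Finset.univ.filter P).filter (fun p : PtF κ => ¬ p.1 = false) =
        (Finset.univ.filter fun ω : Config (Atom κ) => P (true, ω)).image
          (fun ω => (true, ω)) := by
      ext p
      simp only [Finset.mem_filter, Finset.mem_univ, true_and, Finset.mem_image,
        Bool.not_eq_false]
      constructor
      · rintro ⟨hP, hb⟩
        refine ⟨p.2, ?_, Prod.ext hb.symm rfl⟩
        have hp : (true, p.2) = p := Prod.ext hb.symm rfl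
        rw [hp]; exact hP
      · rintro ⟨ω, hω, rfl⟩
        exact ⟨hω, rfl⟩
    rw [this, Finset.card_image_of_injective]
    intro ω ω' h
    exact (Prod.mk.inj h).2

/-- A count over the colourings with `X = A = c` is a count over the far colourings. -/
lemma card_filter_fibre (c : Bool) (S : Config (Atom κ) → Prop) [DecidablePred S] :
    (Finset.univ.filter fun ω : Config (Atom κ) =>
        ω (Sum.inl 0) = c ∧ ω (Sum.inl 1) = c ∧ S ω).card =
      (Finset.univ.filter fun f : Config κ => S (setXA c f)).card := by
  have : (Finset.univ.filter fun ω : Config (Atom κ) =>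
      ω (Sum.inl 0) = c ∧ ω (Sum.inl 1) = c ∧ S ω) =
      (Finset.univ.filter fun f : Config κ => S (setXA c f)).image (setXA c) := by
    ext ω
    simp only [Finset.mem_filter, Finset.mem_univ, true_and, Finset.mem_image]
    constructor
    · rintro ⟨h0, h1, hS⟩
      refine ⟨fun j => ω (Sum.inr j), ?_, (eq_setXA_of h0 h1).symm⟩
      rw [← eq_setXA_of h0 h1]; exact hS
    · rintro ⟨f, hf, rfl⟩
      exact ⟨rfl, rfl, hf⟩
  rw [this, Finset.card_image_of_injective _ (setXA_injective c)]

/-- Splitting a count over the top layer minus the middle by the common colour of `X` and `A`. -/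
lemma card_filter_top (S : Config (Atom κ) → Prop) [DecidablePred S] :
    (Finset.univ.filter fun ω : Config (Atom κ) => ω (Sum.inl 0) = ω (Sum.inl 1) ∧ S ω).card =
      (Finset.univ.filter fun ω : Config (Atom κ) =>
        ω (Sum.inl 0) = false ∧ ω (Sum.inl 1) = false ∧ S ω).card +
      (Finset.univ.filter fun ω : Config (Atom κ) =>
        ω (Sum.inl 0) = true ∧ ω (Sum.inl 1) = true ∧ S ω).card := by
  rw [← Finset.card_filter_add_card_filter_not
    (s := Finset.univ.filter fun ω : Config (Atom κ) => ω (Sum.inl 0) = ω (Sum.inl 1) ∧ S ω)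
    (fun ω : Config (Atom κ) => ω (Sum.inl 0) = false)]
  congr 1
  · rw [Finset.filter_filter]
    refine congrArg Finset.card (Finset.filter_congr ?_)
    intro ω _
    constructor
    · rintro ⟨⟨h01, hS⟩, h0⟩
      exact ⟨h0, by rw [← h01]; exact h0, hS⟩
    · rintro ⟨h0, h1, hS⟩
      exact ⟨⟨by rw [h0, h1], hS⟩, h0⟩
  · rw [Finset.filter_filter]
    refine congrArg Finset.card (Finset.filter_congr ?_)
    intro ω _
    simp only [Bool.not_eq_false]
    constructor
    · rintro ⟨⟨h01, hS⟩, h0⟩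
      exact ⟨h0, by rw [← h01]; exact h0, hS⟩
    · rintro ⟨h0, h1, hS⟩
      exact ⟨⟨by rw [h0, h1], hS⟩, h0⟩

end Counting

section Exchange

variable {E' : Type*} [Fintype E'] [DecidableEq E']

/-- A count over `L₀ ∩ S` with `L₁ ⊆ L₀` splits into `L₁ ∩ S` and `(L₀ ∖ L₁) ∩ S`. -/
lemma card_split_sub {L₀ L₁ S : Set (Config E')} (hL : L₁ ⊆ L₀) :
    (Finset.univ.filter (· ∈ L₀ ∩ S)).card =
      (Finset.univ.filter (· ∈ L₁ ∩ S)).card +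
        ((Finset.univ.filter (· ∈ L₀ ∩ S)).filter (· ∉ L₁)).card := by
  rw [← Finset.card_filter_add_card_filter_not (s := Finset.univ.filter (· ∈ L₀ ∩ S))
    (fun ω => ω ∈ L₁)]
  congr 1
  rw [Finset.filter_filter]
  refine congrArg Finset.card (Finset.filter_congr ?_)
  intro ω _
  constructor
  · rintro ⟨⟨_, hS⟩, hL₁⟩
    exact ⟨hL₁, hS⟩
  · rintro ⟨hL₁, hS⟩
    exact ⟨⟨hL hL₁, hS⟩, hL₁⟩

/-- **The exchange**: for `L₁ ⊆ L₀` and `S₀ ⊆ S₁`,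
`|L₀ ∩ S₀| + |L₁ ∩ S₁| ≤ |L₀ ∩ S₁| + |L₁ ∩ S₀|`. -/
lemma card_exchange {L₀ L₁ S₀ S₁ : Set (Config E')} (hL : L₁ ⊆ L₀) (hS : S₀ ⊆ S₁) :
    (Finset.univ.filter (· ∈ L₀ ∩ S₀)).card + (Finset.univ.filter (· ∈ L₁ ∩ S₁)).card ≤
      (Finset.univ.filter (· ∈ L₀ ∩ S₁)).card + (Finset.univ.filter (· ∈ L₁ ∩ S₀)).card := by
  rw [card_split_sub (S := S₀) hL, card_split_sub (S := S₁) hL]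
  have hsub : (Finset.univ.filter (· ∈ L₀ ∩ S₀)).filter (· ∉ L₁) ⊆
      (Finset.univ.filter (· ∈ L₀ ∩ S₁)).filter (· ∉ L₁) := by
    intro ω hω
    simp only [Finset.mem_filter, Finset.mem_univ, true_and] at hω ⊢
    exact ⟨⟨hω.1.1, hS hω.1.2⟩, hω.2⟩
  have := Finset.card_le_card hsub
  omega

end Exchange

end MixedCube

end Summit.Ventures.PercRepro2
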